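import Summits.ValiantsHypothesis.ValiantsHypothesis.Theorems.LacunarySymmetroidMatrixDescartesCensusDoorA34RootType
import Summits.ValiantsHypothesis.ValiantsHypothesis.Theorems.LacunarySymmetroidMatrixDescartesCensusAltChainLift

/-!
# `MatrixDescartes` census — DOOR A at `(3,4)`: the DEFINITE-WITNESS LAW (every plane sees a definite compression in at most
# four interior gaps between real-line-pair roots)

HONEST FRAMING.  Object-search cell `pub-symmetroid`, route `LacunarySymmetroid`; beside the OPEN typed statement
`Theses.LacunarySymmetroid.DoorA34` (stmt-ValiantsHypothesis-19980, `= DoorA34 = PosRootLawAt 3 4 18`), asserted nowhere.  Continuation of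
`…CensusDoorA34RootRank` / `…RootType` (root layer of a hypothetical nineteen: rank two, conic type `sign tr adj P(r)`, at most nine type
changes).  The exact census read-out of seat val-sym-door-p3 g5 (HOME report DOOR-A34-P3G5-REPORT §2) shows that EVERY census `(3,3)`/`(3,4)`
extremal is a middle-eigenvalue oscillator: all (but a short tail of) its roots have type `−` (real line pairs; inertia step `1 ↔ 2`), where the
type law is slack.  This file adds the first law of the cell that involves the GAPS between such roots, again for ALL supports and with NO
definiteness hypothesis on the letters:

* `quadFormAdjugatePencil c` is not a definition but the explicit polynomial `Σ_{i,j} c_i c_j (adj Σ_l X^{d l} S_l)_{ij}`; `eval_quadForm_adjugate_pencil`: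
  its value at `x` is `cᵀ adj P(x) c` (for invertible `P(x)` this is `det P(x) · cᵀ P(x)⁻¹ c`, i.e. `|c|²`-times the determinant of the compression of
  `P(x)` to the plane `c^⊥` — the dual conic evaluated at the line `c`);
* `support_adjugate_pencil_apply_subset`, `support_quadForm_adjugate_pencil_subset`, `signVariations_quadForm_adjugate_pencil_le` — every adjugate
  ENTRY of the `3 × 3` pencil is `±` a `2 × 2` pencil determinant (`Matrix.adjugate_fin_succ_eq_det_submatrix`), so `cᵀ adj P(x) c` lives on the
  ten PAIR sums and has at most `9` sign variations, for EVERY `c`;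
* `quadForm_adjugate_nonpos_of_type_neg` / `quadForm_adjugate_nonneg_of_type_pos` — at a root of type `−` (resp. `+`), `cᵀ adj P(r) c ≤ 0` (resp. `≥ 0`)
  for every `c` (sign coherence of the rank-one adjugate, `…RootRank`);
* **`sgnChanges_quadForm_adjugate_le_nine`** — along any increasing list of positive points at which `cᵀ adj P(x) c ≠ 0`, its sign changes at most
  `9` times; **`altChain_quadForm_adjugate_le_nine`** — an alternation chain of `cᵀ adj P(x) c` on positive points has length at most `10`.
  READING (the definite-witness law): between consecutive type-`−` roots the value at the roots is `≤ 0`; a point `x` of a gap with `cᵀ adj P(x) c > 0`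
  is a WITNESS that the compression of `P(x)` to `c^⊥` is definite (for `n₋(x) = 1` positive definite, for `n₋(x) = 2` negative definite); so for
  every direction `c` that is not orthogonal to the kernel lines at the roots, the plane `c^⊥` is a definiteness witness in AT MOST FOUR interior
  gaps of a block of type-`−` roots (each witnessed interior gap costs two alternations) — the eigenframe of a nineteen in the census regime must
  ROTATE: no fixed plane can certify the sign of the middle eigenvalue in more than four of its eighteen interior gaps.

NOTHING here bounds `ζ_sym(3,4)`; `DoorA34` stays OPEN; nothing bears on `MatrixDescartes` (stmt-ValiantsHypothesis-18050) or on `VP ≠ VNP`.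
[folklore] Descartes' rule along points + `3 × 3` adjugate bookkeeping; no citation is needed.
-/

-- `Summit.ValiantsHypothesis.ValiantsHypothesis.…` repeats a component by the D-0017 layout
-- (single-conjunct summit), which the `dupNamespace` linter flags; the name is mandated.
set_option linter.dupNamespace false

namespace Summit.ValiantsHypothesis.ValiantsHypothesis.Theorems.LacunarySymmetroidMatrixDescartes.Census

open Polynomial Finset
open scoped BigOperators Polynomial Matrix
open Summit.ValiantsHypothesis.ValiantsHypothesis.Theorems.KPlusLogSqLaw.WindowDescartes (sgnChanges
  sgnChanges_eval_le_signVariations)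

/-! ## Every adjugate entry of the pencil lives on the pair sums -/

/-- Submatrices (two reindexing maps) commute with the pencil construction. [folklore] -/
theorem submatrix_pencil₂ {K m k k' : ℕ} (d : Fin K → ℕ) (S : Fin K → Matrix (Fin m) (Fin m) ℝ)
    (e : Fin k → Fin m) (e' : Fin k' → Fin m) :
    (∑ l, ((X : ℝ[X]) ^ d l) • (S l).map C).submatrix e e'
      = ∑ l, ((X : ℝ[X]) ^ d l) • ((S l).submatrix e e').map C := by
  refine Matrix.ext fun i j => ?_
  simp [Matrix.submatrix_apply, Matrix.sum_apply, Matrix.smul_apply]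

/-- **Every adjugate entry of the `3 × 3` pencil is supported on the pair sums** `{d l + d l'}`: it is `±` the determinant of a
`2 × 2` pencil of submatrices of the letters. [folklore] -/
theorem support_adjugate_pencil_apply_subset (d : Fin 4 → ℕ) (S : Fin 4 → Matrix (Fin 3) (Fin 3) ℝ) (i j : Fin 3) :
    ((∑ l, ((X : ℝ[X]) ^ d l) • (S l).map C).adjugate i j).support
      ⊆ (Finset.univ : Finset (Fin 2 → Fin 4)).image (fun f => ∑ i, d (f i)) := by
  rw [Matrix.adjugate_fin_succ_eq_det_submatrix, submatrix_pencil₂]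
  rcases neg_one_pow_eq_or ℝ[X] (j + i : ℕ) with h | h
  · rw [h, one_mul]; exact support_det_pencil_subset_sumset d _
  · rw [h, neg_one_mul, Polynomial.support_neg]; exact support_det_pencil_subset_sumset d _

/-- **The quadratic form of the adjugate pencil lives on the pair sums**: for every `c : Fin 3 → ℝ`,
`supp (Σ_{i,j} c_i c_j (adj P)_{ij}) ⊆ {d l + d l'}`. [folklore] -/
theorem support_quadForm_adjugate_pencil_subset (d : Fin 4 → ℕ) (S : Fin 4 → Matrix (Fin 3) (Fin 3) ℝ) (c : Fin 3 → ℝ) :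
    (∑ i, ∑ j, C (c i * c j) * (∑ l, ((X : ℝ[X]) ^ d l) • (S l).map C).adjugate i j).support
      ⊆ (Finset.univ : Finset (Fin 2 → Fin 4)).image (fun f => ∑ i, d (f i)) := by
  intro n hn
  by_contra hni
  apply (Polynomial.mem_support_iff.mp hn)
  rw [Polynomial.finsetSum_coeff]
  refine Finset.sum_eq_zero fun i _ => ?_
  rw [Polynomial.finsetSum_coeff]
  refine Finset.sum_eq_zero fun j _ => ?_
  rw [Polynomial.coeff_C_mul]
  have h0 : ((∑ l, ((X : ℝ[X]) ^ d l) • (S l).map C).adjugate i j).coeff n = 0 :=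
    Polynomial.notMem_support_iff.mp fun h => hni (support_adjugate_pencil_apply_subset d S i j h)
  rw [h0, mul_zero]

/-- Hence at most `10` monomials and at most `9` sign variations, for every `c`. [folklore] -/
theorem signVariations_quadForm_adjugate_pencil_le (d : Fin 4 → ℕ) (S : Fin 4 → Matrix (Fin 3) (Fin 3) ℝ)
    (c : Fin 3 → ℝ) :
    (∑ i, ∑ j, C (c i * c j) * (∑ l, ((X : ℝ[X]) ^ d l) • (S l).map C).adjugate i j).signVariations ≤ 9 := by
  set g := ∑ i, ∑ j, C (c i * c j) * (∑ l, ((X : ℝ[X]) ^ d l) • (S l).map C).adjugate i j with hg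
  by_cases h0 : g = 0
  · rw [h0]; simp
  · have h1 := Literature.Computability.AlgebraicComplexity.signVariations_lt_card_support h0
    have h2 : g.support.card ≤ 10 :=
      (Finset.card_le_card (support_quadForm_adjugate_pencil_subset d S c)).trans (card_pairSums_four_le d)
    omega

/-- **Evaluation**: the value at `x` is the quadratic form of `adj P(x)`, `cᵀ adj P(x) c = Σ_{i,j} c_i c_j (adj P(x))_{ij}`. [folklore] -/
theorem eval_quadForm_adjugate_pencil (d : Fin 4 → ℕ) (S : Fin 4 → Matrix (Fin 3) (Fin 3) ℝ) (c : Fin 3 → ℝ) (x : ℝ) :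
    (∑ i, ∑ j, C (c i * c j) * (∑ l, ((X : ℝ[X]) ^ d l) • (S l).map C).adjugate i j).eval x
      = c ⬝ᵥ ((∑ l, x ^ d l • S l).adjugate *ᵥ c) := by
  set M := (∑ l, ((X : ℝ[X]) ^ d l) • (S l).map C) with hM
  have h2 : M.adjugate.map (eval x) = (M.map (eval x)).adjugate := by
    have := RingHom.map_adjugate (evalRingHom x) M
    simpa [RingHom.mapMatrix_apply, Polynomial.coe_evalRingHom] using this
  have h3 : ∀ i j, (M.adjugate i j).eval x = (∑ l, x ^ d l • S l).adjugate i j := by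
    intro i j
    have := congrFun (congrFun h2 i) j
    rw [Matrix.map_apply] at this
    rw [this, hM, map_eval_pencil]
  simp only [Polynomial.eval_finsetSum, Polynomial.eval_mul, Polynomial.eval_C, h3, dotProduct, Matrix.mulVec,
    Finset.mul_sum]
  refine Finset.sum_congr rfl fun i _ => Finset.sum_congr rfl fun j _ => ?_
  ring

/-! ## Signs at the roots (from the rank-one adjugate) -/

/-- At a root of TYPE `−` (real symmetric singular `A` with `tr adj A < 0`): `cᵀ adj A c ≤ 0` for every `c`. [folklore] -/
theorem quadForm_adjugate_nonpos_of_type_neg {A : Matrix (Fin 3) (Fin 3) ℝ} (hA : A.IsSymm) (hdet : A.det = 0)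
    (hneg : A.adjugate.trace < 0) (c : Fin 3 → ℝ) : c ⬝ᵥ (A.adjugate *ᵥ c) ≤ 0 := by
  have h := trace_mul_quadForm_adjugate_nonneg hA hdet c
  by_contra hc
  push Not at hc
  have : A.adjugate.trace * (c ⬝ᵥ (A.adjugate *ᵥ c)) < 0 := mul_neg_of_neg_of_pos hneg hc
  linarith

/-- At a root of TYPE `+` (`tr adj A > 0`): `cᵀ adj A c ≥ 0` for every `c`. [folklore] -/
theorem quadForm_adjugate_nonneg_of_type_pos {A : Matrix (Fin 3) (Fin 3) ℝ} (hA : A.IsSymm) (hdet : A.det = 0)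
    (hpos : 0 < A.adjugate.trace) (c : Fin 3 → ℝ) : 0 ≤ c ⬝ᵥ (A.adjugate *ᵥ c) := by
  have h := trace_mul_quadForm_adjugate_nonneg hA hdet c
  by_contra hc
  push Not at hc
  have : A.adjugate.trace * (c ⬝ᵥ (A.adjugate *ᵥ c)) < 0 := mul_neg_of_pos_of_neg hpos hc
  linarith

/-! ## The definite-witness law -/

/-- **Descartes along points for `cᵀ adj P(x) c`.**  For every real `3 × 3` four-nomial pencil (any letters, any support), every
`c`, and every increasing list of positive points at which `cᵀ adj P(x) c ≠ 0`, the sign of `cᵀ adj P(x) c` changes at most `9` times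
along the list. [folklore] -/
theorem sgnChanges_quadForm_adjugate_le_nine (d : Fin 4 → ℕ) (S : Fin 4 → Matrix (Fin 3) (Fin 3) ℝ) (c : Fin 3 → ℝ)
    (xs : List ℝ) (hsort : xs.Pairwise (· < ·)) (hpos : ∀ x ∈ xs, 0 < x)
    (hne : ∀ x ∈ xs, c ⬝ᵥ ((∑ l, x ^ d l • S l).adjugate *ᵥ c) ≠ 0) :
    sgnChanges (xs.map fun t => c ⬝ᵥ ((∑ l, t ^ d l • S l).adjugate *ᵥ c)) ≤ 9 := by
  set g := ∑ i, ∑ j, C (c i * c j) * (∑ l, ((X : ℝ[X]) ^ d l) • (S l).map C).adjugate i j with hg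
  have hmap : (xs.map fun t => c ⬝ᵥ ((∑ l, t ^ d l • S l).adjugate *ᵥ c)) = xs.map fun t => g.eval t := by
    refine List.map_congr_left fun t _ => ?_
    rw [hg, eval_quadForm_adjugate_pencil]
  rw [hmap]
  have hne' : ∀ y ∈ xs, g.eval y ≠ 0 := fun y hy => by
    rw [hg, eval_quadForm_adjugate_pencil]; exact hne y hy
  exact (sgnChanges_eval_le_signVariations g xs hsort hpos hne').trans (signVariations_quadForm_adjugate_pencil_le d S c)

/-- **THE DEFINITE-WITNESS LAW (alternation form).**  For every real `3 × 3` four-nomial pencil, every `c`, and every alternation chain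
`0 < a₀ < a₁ < ⋯ < a_N` of `cᵀ adj P(x) c` (consecutive values of opposite strict signs), `N ≤ 9`.  With the sign lemmas above: take
`a₀, a₂, a₄, …` to be type-`−` roots of a symmetric nineteen (where `cᵀ adj P c < 0` as soon as `c` is off the kernel line) and
`a₁, a₃, …` to be WITNESS points in distinct gaps (where `cᵀ adj P(x) c > 0`, i.e. the compression of `P(x)` to `c^⊥` is definite); then the
number of witnessed gaps is at most `4` (interior) — no fixed plane certifies the sign of the middle eigenvalue in five interior gaps. [folklore] -/
theorem altChain_quadForm_adjugate_le_nine (d : Fin 4 → ℕ) (S : Fin 4 → Matrix (Fin 3) (Fin 3) ℝ) (c : Fin 3 → ℝ)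
    {N : ℕ} {s : ℝ} {a : Fin (N + 1) → ℝ}
    (h : AltChain (∑ i, ∑ j, C (c i * c j) * (∑ l, ((X : ℝ[X]) ^ d l) • (S l).map C).adjugate i j) N s a) :
    N ≤ 9 := by
  set g := ∑ i, ∑ j, C (c i * c j) * (∑ l, ((X : ℝ[X]) ^ d l) • (S l).map C).adjugate i j with hg
  calc N ≤ (g.roots.toFinset.filter (fun t => 0 < t)).card := le_card_posRoots_of_altChain h
    _ ≤ g.roots.countP (fun t => 0 < t) :=
        KPlusLogSqLaw.WindowDescartes.card_roots_filter_le_countP_pos g (le_refl (0 : ℝ))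
    _ ≤ g.signVariations := g.roots_countP_pos_le_signVariations
    _ ≤ 9 := signVariations_quadForm_adjugate_pencil_le d S c

/-- **The definite-witness law at the roots of a nineteen (gap form).**  Let `P = Σ_l X^{d l} S_l` (real symmetric letters, any support) have
`19` distinct positive det-roots, let `r₀ < r₁ < ⋯ < r_m` be positive det-roots of type `−` at which `c` is off the kernel line
(`cᵀ adj P(r_k) c ≠ 0`, hence `< 0`), and let `x₁, …, x_m` with `r_{k-1} < x_k < r_k` be points with `cᵀ adj P(x_k) c > 0` (the plane `c^⊥`
witnesses a definite compression in each of the `m` gaps).  Then `m ≤ 4`. [folklore] -/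
theorem witnessed_gaps_le_four (d : Fin 4 → ℕ) (S : Fin 4 → Matrix (Fin 3) (Fin 3) ℝ) (hS : ∀ l, (S l).IsSymm)
    (c : Fin 3 → ℝ) {m : ℕ} (r : Fin (m + 1) → ℝ) (x : Fin m → ℝ)
    (hr0 : 0 < r 0) (hrx : ∀ k : Fin m, r k.castSucc < x k) (hxr : ∀ k : Fin m, x k < r k.succ)
    (hroot : ∀ k, (∑ l, r k ^ d l • S l).det = 0)
    (htype : ∀ k, (∑ l, r k ^ d l • S l).adjugate.trace < 0)
    (hoff : ∀ k, c ⬝ᵥ ((∑ l, r k ^ d l • S l).adjugate *ᵥ c) ≠ 0)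
    (hwit : ∀ k, 0 < c ⬝ᵥ ((∑ l, x k ^ d l • S l).adjugate *ᵥ c)) : m ≤ 4 := by
  -- the interleaved chain `r 0, x 0, r 1, x 1, …, r m` of length `2m + 1`
  set g := ∑ i, ∑ j, C (c i * c j) * (∑ l, ((X : ℝ[X]) ^ d l) • (S l).map C).adjugate i j with hg
  have hgr : ∀ k, g.eval (r k) < 0 := fun k => by
    rw [hg, eval_quadForm_adjugate_pencil]
    exact lt_of_le_of_ne (quadForm_adjugate_nonpos_of_type_neg (isSymm_pencil_eval d hS (r k)) (hroot k) (htype k) c)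
      (hoff k)
  have hgx : ∀ k, 0 < g.eval (x k) := fun k => by rw [hg, eval_quadForm_adjugate_pencil]; exact hwit k
  let a : Fin (2 * m + 1) → ℝ := fun i => if h : (i : ℕ) % 2 = 0 then r ⟨i / 2, by omega⟩ else x ⟨i / 2, by omega⟩
  have ha_even : ∀ (k : ℕ) (hk : 2 * k < 2 * m + 1), a ⟨2 * k, hk⟩ = r ⟨k, by omega⟩ := by
    intro k hk
    simp only [a, Nat.mul_mod_right, dif_pos]
    congr 1; ext; simp
  have ha_odd : ∀ (k : ℕ) (hk : 2 * k + 1 < 2 * m + 1), a ⟨2 * k + 1, hk⟩ = x ⟨k, by omega⟩ := by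
    intro k hk
    have h1 : (2 * k + 1) % 2 ≠ 0 := by omega
    simp only [a, dif_neg h1]
    congr 1; ext; simp; omega
  have hstep : ∀ i : Fin (2 * m), a i.castSucc < a i.succ ∧ g.eval (a i.castSucc) * g.eval (a i.succ) < 0 := by
    intro i
    obtain ⟨i, hi⟩ := i
    rcases Nat.even_or_odd i with ⟨k, hk⟩ | ⟨k, hk⟩
    · subst hk
      have e1 : a (Fin.castSucc ⟨k + k, hi⟩) = r ⟨k, by omega⟩ := by
        rw [show (Fin.castSucc ⟨k + k, hi⟩ : Fin (2 * m + 1)) = ⟨2 * k, by omega⟩ from by ext; simp; omega]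
        exact ha_even k (by omega)
      have e2 : a (Fin.succ ⟨k + k, hi⟩) = x ⟨k, by omega⟩ := by
        rw [show (Fin.succ ⟨k + k, hi⟩ : Fin (2 * m + 1)) = ⟨2 * k + 1, by omega⟩ from by ext; simp; omega]
        exact ha_odd k (by omega)
      rw [e1, e2]
      exact ⟨hrx ⟨k, by omega⟩, mul_neg_of_neg_of_pos (hgr _) (hgx _)⟩
    · subst hk
      have e1 : a (Fin.castSucc ⟨2 * k + 1, hi⟩) = x ⟨k, by omega⟩ := by
        rw [show (Fin.castSucc ⟨2 * k + 1, hi⟩ : Fin (2 * m + 1)) = ⟨2 * k + 1, by omega⟩ from by ext; simp]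
        exact ha_odd k (by omega)
      have e2 : a (Fin.succ ⟨2 * k + 1, hi⟩) = r ⟨k + 1, by omega⟩ := by
        rw [show (Fin.succ ⟨2 * k + 1, hi⟩ : Fin (2 * m + 1)) = ⟨2 * (k + 1), by omega⟩ from by ext; simp; omega]
        exact ha_even (k + 1) (by omega)
      rw [e1, e2]
      refine ⟨?_, mul_neg_of_pos_of_neg (hgx _) (hgr _)⟩
      have := hxr ⟨k, by omega⟩
      simpa [Fin.succ_mk] using this
  have hchain : AltChain g (2 * m) (-1) a := by
    refine ⟨?_, ?_, fun i => (hstep i).2, ?_⟩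
    · exact Fin.strictMono_iff_lt_succ.2 fun i => (hstep i).1
    · have e0 : a 0 = r ⟨0, by omega⟩ := by
        rw [show (0 : Fin (2 * m + 1)) = ⟨2 * 0, by omega⟩ from by ext; simp]
        exact ha_even 0 (by omega)
      rw [e0]; exact hr0
    · have e0 : a 0 = r ⟨0, by omega⟩ := by
        rw [show (0 : Fin (2 * m + 1)) = ⟨2 * 0, by omega⟩ from by ext; simp]
        exact ha_even 0 (by omega)
      rw [e0]
      have := hgr ⟨0, by omega⟩
      nlinarith
  have := altChain_quadForm_adjugate_le_nine d S c hchain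
  omega

end Summit.ValiantsHypothesis.ValiantsHypothesis.Theorems.LacunarySymmetroidMatrixDescartes.Census
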